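import Literature.Geometry.Symplectic.PALFBoxProduct
import Literature.Geometry.Symplectic.PALFFibreMorse
import HarnessLib

/-!
# Kas' Morse function on a Lefschetz fibration over the disc: the function

Topic `Literature/Geometry/Symplectic` (fact seat
`provefact-Literature.Geometry.Symplectic.Oba2016_s-add47373d4`; Kas 1980 §2, Gompf–Stipsicz 1999
§8.2: *"`A ∘ f + ε B` … where `A` has a single minimum at a regular value and `B` extends a Morse
function of the fibre"*).  This file packages the data (`PALF.KasSetup`) and defines the function

  `G = ‖f - c₀‖² + ε (bb ∘ σ + β(f) · Dfun)`,  `Dfun = m ∘ psiHat - bb ∘ σ` on the interior tube,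

where `σ` is a collar coordinate of `∂W`, `bb` the collar profile, `m` a Morse function of the
fibre manifold `F°` with collar profile `bb ∘ τ` (`PALF.exists_fibreMorse`), `β` a bump of the base
equal to `1` on an inner box and supported in the product tube of `PALF.BoxProduct`.  Proved here:
`G` is smooth, and its three local forms — the near-boundary form `‖f - c₀‖² + ε bb ∘ σ` on
`{σ < c}` and off the tube, and the separated form `‖f - c₀‖² + ε m ∘ psiHat` over the inner box.
Everything is proved; the only definitions are the data package and the two functions.

## References

* A. Kas, *On the handlebody decomposition associated to a Lefschetz fibration*, Pacific J.
  Math. 89 (1980), §2. [Kas1980]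
* R. E. Gompf, A. I. Stipsicz, *4-Manifolds and Kirby Calculus*, GSM 20 (1999), §8.2.
  [GompfStipsiczGSM1999]
-/

open scoped Manifold ContDiff Topology
open Set Function Filter

noncomputable section

namespace Literature.Geometry.Symplectic

open Literature.Topology.FourManifolds

universe u

variable {W : Type u} [TopologicalSpace W] [ChartedSpace (EuclideanHalfSpace 4) W]
  [IsManifold (𝓡∂ 4) ∞ W]
  {o : SmoothOrientation (𝓡∂ 4) W} {b : BoundaryData (𝓡∂ 4) W (𝓡 3)}

namespace PALF

/-- **The data of Kas' Morse function** `‖f - c₀‖² + ε (bb ∘ σ + β(f) · (m ∘ psiHat - bb ∘ σ))`: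
a regular value `c₀`, nested boxes `δ' < δ'' < δ` about it with the product structure `B` over
the `δ`-box preserving the collar levels of `σ = D.f` below `s₀`, a collar width `c` with
`2c ≤ s₀`, a smooth collar profile `bb`, constant on `[2c, ∞)`, a Morse function `m` of the fibre
manifold equal to `bb ∘ τ` on `{τ ≤ c}` with critical points in `{τ > 3c/2}`, a smooth bump `β`
of the base (`= 1` on the closed `δ'`-box, `= 0` off the open `δ''`-box) and `ε > 0`.
[cite: Kas1980, §2] [cite: GompfStipsiczGSM1999, §8.2] -/
structure KasSetup (P : PALF o b) (D : FlowoutInput 3 W) where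
  /-- The regular value at the centre of the tube. -/
  c₀ : EuclideanSpace ℝ (Fin 2)
  /-- Half-widths of the inner, middle and outer boxes. -/
  δ' : ℝ
  δ'' : ℝ
  δ : ℝ
  hδ' : 0 < δ'
  hδ'δ'' : δ' < δ''
  hδ''δ : δ'' < δ
  /-- `c₀` is a regular value. -/
  hc : c₀ ∉ P.f '' ↑P.crit
  /-- The product structure over the `δ`-box. -/
  B : BoxProduct P c₀ δ
  /-- The level below which the product structure preserves `σ`. -/
  s₀ : ℝ
  hΨlev : ∀ x, (∀ i, |P.f x i - c₀ i| < δ) → D.f x < s₀ → D.f (B.Ψ x) = D.f x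
  hΦlev : ∀ y, P.f y = c₀ → D.f y < s₀ → ∀ u : EuclideanSpace ℝ (Fin 2), (∀ i, |u i - c₀ i| < δ) →
    D.f (B.Φ (u, y)) = D.f y
  /-- The collar width. -/
  c : ℝ
  hc0 : 0 < c
  hcs₀ : 2 * c ≤ s₀
  /-- The collar profile. -/
  bb : ℝ → ℝ
  hbb : ContDiff ℝ ∞ bb
  hbb_const : ∀ t, 2 * c ≤ t → bb t = bb (2 * c)
  /-- The fibre Morse function with collar profile `bb ∘ τ`. -/
  m : RegularFibreOn (P.isRegularFibreOn_interior hc) → ℝ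
  hm : IsMorse (𝓡 2) m
  hmcol : ∀ q, D.f (RegularFibreOn.incl (P.isRegularFibreOn_interior hc) q) ≤ c →
    m q = bb (D.f (RegularFibreOn.incl (P.isRegularFibreOn_interior hc) q))
  hmcrit : ∀ q, IsMCriticalPt (𝓡 2) m q →
    3 * c / 2 < D.f (RegularFibreOn.incl (P.isRegularFibreOn_interior hc) q)
  /-- The bump of the base. -/
  β : EuclideanSpace ℝ (Fin 2) → ℝ
  hβ : ContDiff ℝ ∞ β
  hβ1 : ∀ u : EuclideanSpace ℝ (Fin 2), (∀ i, |u i - c₀ i| ≤ δ') → β u = 1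
  hβ0 : ∀ (u : EuclideanSpace ℝ (Fin 2)) (i : Fin 2), δ'' ≤ |u i - c₀ i| → β u = 0
  /-- The size of the fibre term. -/
  ε : ℝ
  hε : 0 < ε

variable {P : PALF o b} {D : FlowoutInput 3 W} (S : KasSetup P D)

namespace KasSetup

/-- The regular fibre structure of the setup. [folklore] -/
theorem hF : IsRegularFibreOn (𝓡∂ 4) (show 2 + 2 = 4 from rfl) P.f S.c₀ ((𝓡∂ 4).interior W) :=
  P.isRegularFibreOn_interior S.hc

/-- The interior tube `T° = f⁻¹(Q) ∩ int W` of the setup. [folklore] -/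
def tube : Set W := {x : W | ∀ i, |P.f x i - S.c₀ i| < S.δ} ∩ (𝓡∂ 4).interior W

/-- The interior tube is open. [folklore] -/
theorem isOpen_tube : IsOpen S.tube := BoxProduct.isOpen_tube P S.c₀ S.δ

/-- Membership in the tube, unfolded. [folklore] -/
theorem mem_tube_iff {x : W} : x ∈ S.tube ↔ (∀ i, |P.f x i - S.c₀ i| < S.δ) ∧ (𝓡∂ 4).IsInteriorPoint x :=
  Iff.rfl

/-- **The fibre term** `Dfun = m ∘ psiHat - bb ∘ σ` on the interior tube, `0` elsewhere.
[cite: Kas1980, §2] -/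
def Dfun (x : W) : ℝ := by
  classical
  exact if h : x ∈ S.tube then
    S.m ⟨S.B.Ψ x, S.B.Ψ_mem h.1 h.2⟩ - S.bb (D.f x) else 0

/-- **Kas' function** `G = ‖f - c₀‖² + ε (bb ∘ σ + β(f) · Dfun)`. [cite: Kas1980, §2]
[cite: GompfStipsiczGSM1999, §8.2] -/
def G (x : W) : ℝ := ‖P.f x - S.c₀‖ ^ 2 + S.ε * (S.bb (D.f x) + S.β (P.f x) * S.Dfun x)

/-- The near-boundary form `G₀ = ‖f - c₀‖² + ε bb ∘ σ`. [cite: Kas1980, §2] -/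
def G₀ (x : W) : ℝ := ‖P.f x - S.c₀‖ ^ 2 + S.ε * S.bb (D.f x)

/-- The near-boundary form is smooth. [folklore] -/
theorem contMDiff_G₀ : ContMDiff (𝓡∂ 4) 𝓘(ℝ, ℝ) ∞ S.G₀ :=
  ((contDiff_norm_sq ℝ).comp_contMDiff (P.contMDiff.sub contMDiff_const)).add
    (contMDiff_const.mul (S.hbb.comp_contMDiff D.f_smooth))

/-! ### The fibre term -/

/-- On the tube, the fibre term in terms of `psiHat` (any base point). [folklore] -/
theorem Dfun_eq_of_mem {x : W} (hx : x ∈ S.tube) (q : RegularFibreOn S.hF) :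
    S.Dfun x = S.m (S.B.psiHat S.hF q x) - S.bb (D.f x) := by
  classical
  unfold Dfun
  rw [dif_pos hx]
  congr 2
  apply Subtype.ext
  show S.B.Ψ x = RegularFibreOn.incl S.hF (S.B.psiHat S.hF q x)
  rw [S.B.incl_psiHat q hx.1 hx.2]

/-- Off the tube the fibre term vanishes. [folklore] -/
theorem Dfun_eq_zero_of_not_mem {x : W} (hx : x ∉ S.tube) : S.Dfun x = 0 := by
  classical
  unfold Dfun
  rw [dif_neg hx]

/-- **The fibre term vanishes below the collar level `c`**: for `σ x < c` (and, if `x` is in the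
tube, `σ (Ψ x) = σ x ≤ c`, so `m = bb ∘ τ` there). [cite: Kas1980, §2] -/
theorem Dfun_eq_zero_of_lt {x : W} (hx : D.f x < S.c) : S.Dfun x = 0 := by
  classical
  by_cases hxT : x ∈ S.tube
  · unfold Dfun
    rw [dif_pos hxT]
    have hlev : D.f (S.B.Ψ x) = D.f x := S.hΨlev x hxT.1 (by linarith [S.hcs₀, S.hc0])
    have h1 : D.f (RegularFibreOn.incl S.hF ⟨S.B.Ψ x, S.B.Ψ_mem hxT.1 hxT.2⟩) ≤ S.c := by
      show D.f (S.B.Ψ x) ≤ S.c; rw [hlev]; exact hx.le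
    rw [S.hmcol _ h1]
    show S.bb (D.f (S.B.Ψ x)) - S.bb (D.f x) = 0
    rw [hlev, sub_self]
  · exact S.Dfun_eq_zero_of_not_mem hxT

/-- **The fibre term is smooth on the tube** (`psiHat` is smooth there,
`PALF.BoxProduct.contMDiffOn_psiHat`). [cite: Kas1980, §2] -/
theorem contMDiffOn_Dfun : ContMDiffOn (𝓡∂ 4) 𝓘(ℝ, ℝ) ∞ S.Dfun S.tube := by
  intro x hx
  set q : RegularFibreOn S.hF := ⟨S.B.Ψ x, S.B.Ψ_mem hx.1 hx.2⟩
  have h1 : ContMDiffOn (𝓡∂ 4) 𝓘(ℝ, ℝ) ∞ (fun y => S.m (S.B.psiHat S.hF q y) - S.bb (D.f y)) S.tube :=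
    (S.hm.1.comp_contMDiffOn (S.B.contMDiffOn_psiHat q)).sub (S.hbb.comp_contMDiff D.f_smooth).contMDiffOn
  exact (h1 x hx).congr (fun y hy => S.Dfun_eq_of_mem hy q) (S.Dfun_eq_of_mem hx q)

/-! ### The local forms of `G` -/

/-- Pointwise, `G = G₀ + ε β(f) Dfun`. [folklore] -/
theorem G_eq (x : W) : S.G x = S.G₀ x + S.ε * (S.β (P.f x) * S.Dfun x) := by
  simp only [G, G₀]; ring

/-- **Near-boundary form**: on the open set `{σ < c}`, `G = ‖f - c₀‖² + ε bb ∘ σ`.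
[cite: Kas1980, §2] -/
theorem G_eventuallyEq_G₀_of_lt {x : W} (hx : D.f x < S.c) : S.G =ᶠ[𝓝 x] S.G₀ := by
  filter_upwards [(isOpen_lt D.f_smooth.continuous continuous_const).mem_nhds hx] with y hy
  rw [S.G_eq, S.Dfun_eq_zero_of_lt hy, mul_zero, mul_zero, add_zero]

/-- Off the open `δ''`-box the bump vanishes near `f x`. [folklore] -/
theorem β_comp_eventuallyEq_zero {x : W} (hx : ∃ i, S.δ'' < |P.f x i - S.c₀ i|) :
    (fun y => S.β (P.f y)) =ᶠ[𝓝 x] fun _ => 0 := by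
  obtain ⟨i, hi⟩ := hx
  have ho : IsOpen {y : W | S.δ'' < |P.f y i - S.c₀ i|} :=
    isOpen_lt continuous_const ((continuous_abs.comp ((((EuclideanSpace.proj i).continuous).comp
      P.contMDiff.continuous).sub continuous_const)))
  filter_upwards [ho.mem_nhds hi] with y hy
  exact S.hβ0 _ i hy.le

/-- **Near-boundary form off the middle box**: if `f x` lies off the closed `δ''`-box then
`G = ‖f - c₀‖² + ε bb ∘ σ` near `x`. [cite: Kas1980, §2] -/
theorem G_eventuallyEq_G₀_of_not_mem {x : W} (hx : ∃ i, S.δ'' < |P.f x i - S.c₀ i|) :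
    S.G =ᶠ[𝓝 x] S.G₀ := by
  filter_upwards [S.β_comp_eventuallyEq_zero hx] with y hy
  rw [S.G_eq, hy, zero_mul, mul_zero, add_zero]

/-- **Separated form over the inner box**: on the open set `T° ∩ f⁻¹(open δ'-box)`,
`G = ‖f - c₀‖² + ε m ∘ psiHat`. [cite: Kas1980, §2] [cite: GompfStipsiczGSM1999, §8.2] -/
theorem G_eventuallyEq_separated {x : W} (hx : x ∈ S.tube) (hx' : ∀ i, |P.f x i - S.c₀ i| < S.δ')
    (q : RegularFibreOn S.hF) :
    S.G =ᶠ[𝓝 x] fun y => ‖P.f y - S.c₀‖ ^ 2 + S.ε * S.m (S.B.psiHat S.hF q y) := by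
  have ho : IsOpen (S.tube ∩ {y : W | ∀ i, |P.f y i - S.c₀ i| < S.δ'}) :=
    S.isOpen_tube.inter ((isOpen_setOf_forall_abs_sub_lt S.c₀ S.δ').preimage P.contMDiff.continuous)
  filter_upwards [ho.mem_nhds ⟨hx, hx'⟩] with y hy
  rw [S.G_eq, S.Dfun_eq_of_mem hy.1 q, S.hβ1 _ fun i => (hy.2 i).le]
  simp only [G₀]; ring

/-- **Kas' function is smooth.**  Near `{σ < c}` and off the middle box it is the near-boundary
form; elsewhere the point lies in the interior tube, where the fibre term is smooth.
[cite: Kas1980, §2] -/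
theorem contMDiff_G : ContMDiff (𝓡∂ 4) 𝓘(ℝ, ℝ) ∞ S.G := by
  intro x
  by_cases h1 : D.f x < S.c
  · exact S.contMDiff_G₀.contMDiffAt.congr_of_eventuallyEq (S.G_eventuallyEq_G₀_of_lt h1)
  by_cases h2 : ∃ i, S.δ'' < |P.f x i - S.c₀ i|
  · exact S.contMDiff_G₀.contMDiffAt.congr_of_eventuallyEq (S.G_eventuallyEq_G₀_of_not_mem h2)
  · -- `x` lies in the interior tube
    push Not at h2
    have hxi : (𝓡∂ 4).IsInteriorPoint x := by
      by_contra h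
      have hb : x ∈ (𝓡∂ 4).boundary W := ((𝓡∂ 4).isInteriorPoint_or_isBoundaryPoint x).resolve_left h
      have := (D.f_eq_zero_iff x).2 hb
      exact h1 (by rw [this]; exact S.hc0)
    have hxT : x ∈ S.tube := ⟨fun i => lt_of_le_of_lt (h2 i) S.hδ''δ, hxi⟩
    have h3 : ContMDiffAt (𝓡∂ 4) 𝓘(ℝ, ℝ) ∞ (fun y => S.G₀ y + S.ε * (S.β (P.f y) * S.Dfun y)) x :=
      S.contMDiff_G₀.contMDiffAt.add (contMDiffAt_const.mul
        (((S.hβ.comp_contMDiff P.contMDiff).contMDiffAt).mul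
          (S.contMDiffOn_Dfun.contMDiffAt (S.isOpen_tube.mem_nhds hxT))))
    exact h3.congr_of_eventuallyEq (Eventually.of_forall fun y => S.G_eq y)

end KasSetup

end PALF

end Literature.Geometry.Symplectic

end
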